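import Mathlib
import HarnessLib
import Summits.Ventures.LatticeQCDFlow.Exactness.SU2A0Moments
import Summits.Ventures.LatticeQCDFlow.Exactness.SemicircleLaw

/-!
# The `a₀` marginal of Haar measure on SU(2) is the semicircle law `(2/π)√(1 − a₀²) da₀`

HONEST FRAMING: exact (Metropolis-corrected) sampling algorithms for lattice gauge theory;
figures of merit are autocorrelation/cost numbers at stated couplings and volumes; no
continuum-physics claim.

Venture `LatticeQCDFlow` (cell pub-lqcd), topic `Exactness`, FANOUT row 9 (eng-latcore).  The SU(2)
heat bath of the engine (`csrc/latcore_template.c`, Kennedy–Pendleton / Creutz) samples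
`a₀ = Re tr U / 2` from the density `∝ √(1 − a₀²) e^{βk a₀}` on `[-1, 1]` and an independent uniform
direction; acceptance test A3 checks the sampled `a₀` against that density by histogram.  That this
density IS the `a₀`-law of the one-link Gibbs law `e^{βk a₀(U)} dHaar_SU(2)(U)` rests on the fact that
the `a₀`-marginal of Haar measure on SU(2) is `(2/π)√(1 − a₀²) da₀` (Haar(SU(2)) = normalised surface
measure of `S³`).  This file proves that fact about Mathlib's Haar measure WITHOUT the `S³` geometry:
both laws satisfy the same Stein identity (`SU2A0Moments.lean`, `SemicircleLaw.lean`), hence the same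
moment recursion with the same initial values, hence have equal moments, and finite measures on a
compact interval are determined by their moments.  NEW WORK of the cell; nothing is cited as a fact.

* **`su2Moment_zero_eq_semicircleMoment`** — `∫ a₀^k dHaar_SU(2) = ∫_{-1}^{1} t^k (2/π)√(1 − t²) dt`;
* **`map_su2a0_haarProbability`** — `(Haar_SU(2)).map a₀ = semicircleLaw`;
* **`map_su2a0_linkLaw`** — for every real `c` (`= βk`), the `a₀`-law of `e^{c a₀(U)} dHaar_SU(2)(U)` is
  `(2/π)√(1 − t²) e^{c t} dt` (unnormalised on both sides) — the reference law of A3.  By the right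
  invariance of Haar measure the one-link law with staple sum `k ŝ` (`ŝ ∈ SU(2)`) is the right
  translate by `ŝ⁻¹` of the case treated here.
-/

namespace Summit.Ventures.LatticeQCDFlow.Exactness

open MeasureTheory Set
open scoped ENNReal

/-- `a₀` is continuous. -/
theorem continuous_su2a0 : Continuous su2a0 := by
  unfold su2a0
  exact (Complex.continuous_re.comp (continuous_subtype_val.matrix_trace)).div_const _

/-- **Equal moments**: the Haar moments of `a₀` are the moments of the semicircle law. -/
theorem su2Moment_zero_eq_semicircleMoment (k : ℕ) : su2Moment 0 k = semicircleMoment k := by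
  induction k using Nat.twoStepInduction with
  | zero => rw [su2Moment_zero_zero, semicircleMoment_zero]
  | one => rw [su2Moment_zero_one, semicircleMoment_one]
  | more n h0 _ =>
    have a := su2Moment_zero_rec (n + 1)
    have b := semicircleMoment_rec (n + 1)
    simp only [Nat.add_sub_cancel] at a b
    rw [h0] at a
    have hpos : ((n + 1 : ℕ) : ℝ) + 3 ≠ 0 := by positivity
    exact mul_left_cancel₀ hpos (a.trans b.symm)

/-- **The `a₀` marginal of Haar measure on SU(2) is the semicircle law `(2/π)√(1 − t²) dt`.** -/
theorem map_su2a0_haarProbability :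
    (Literature.MathematicalPhysics.QuantumFieldTheory.haarProbability
        (Matrix.specialUnitaryGroup (Fin 2) ℂ)).map su2a0 = semicircleLaw := by
  set μ := Literature.MathematicalPhysics.QuantumFieldTheory.haarProbability
    (Matrix.specialUnitaryGroup (Fin 2) ℂ)
  have hm : Measurable su2a0 := continuous_su2a0.measurable
  haveI : IsProbabilityMeasure (μ.map su2a0) := Measure.isProbabilityMeasure_map hm.aemeasurable
  refine measure_eq_of_forall_integral_pow_eq (a := -1) (b := 1) ?_ semicircleLaw_compl_Icc fun k => ?_
  · rw [Measure.map_apply hm measurableSet_Icc.compl]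
    have : su2a0 ⁻¹' (Icc (-1 : ℝ) 1)ᶜ = ∅ := by
      ext U
      simp only [mem_preimage, mem_compl_iff, mem_Icc, mem_empty_iff_false, iff_false, not_not]
      exact abs_le.mp (abs_su2a0_le_one U)
    rw [this, measure_empty]
  · rw [integral_map hm.aemeasurable (continuous_pow k).aestronglyMeasurable,
      integral_pow_semicircleLaw, ← su2Moment_zero_eq_semicircleMoment]
    simp [su2Moment, μ]

/-- **The `a₀`-law of the SU(2) link weight.**  For every real `c`, the image under `a₀` of the
(unnormalised) one-link law `e^{c a₀(U)} dHaar_SU(2)(U)` is `(2/π)√(1 − t²) e^{c t} dt` — the law the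
heat bath samples `a₀` from (acceptance test A3's reference density, up to normalisation). -/
theorem map_su2a0_linkLaw (c : ℝ) :
    ((Literature.MathematicalPhysics.QuantumFieldTheory.haarProbability
        (Matrix.specialUnitaryGroup (Fin 2) ℂ)).withDensity
          (fun U => ENNReal.ofReal (Real.exp (c * su2a0 U)))).map su2a0
      = volume.withDensity (fun t => ENNReal.ofReal (semicircleDensity t * Real.exp (c * t))) := by
  set μ := Literature.MathematicalPhysics.QuantumFieldTheory.haarProbability
    (Matrix.specialUnitaryGroup (Fin 2) ℂ)
  have hm : Measurable su2a0 := continuous_su2a0.measurable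
  have hh : Measurable fun t : ℝ => ENNReal.ofReal (Real.exp (c * t)) :=
    (Real.measurable_exp.comp (measurable_const.mul measurable_id)).ennreal_ofReal
  -- pushing forward a density that factors through the map (change of variables)
  have h1 : (μ.withDensity (fun U => ENNReal.ofReal (Real.exp (c * su2a0 U)))).map su2a0
      = (μ.map su2a0).withDensity (fun t => ENNReal.ofReal (Real.exp (c * t))) := by
    ext s hs
    rw [Measure.map_apply hm hs, withDensity_apply _ (hm hs), withDensity_apply _ hs,
      setLIntegral_map hs hh hm]
  rw [h1, map_su2a0_haarProbability, semicircleLaw,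
    ← withDensity_mul _ continuous_semicircleDensity.measurable.ennreal_ofReal hh]
  congr 1
  funext t
  simp only [Pi.mul_apply, ENNReal.ofReal_mul (semicircleDensity_nonneg t)]

end Summit.Ventures.LatticeQCDFlow.Exactness
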